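import Summits.AtomisticToContinuum.HydrodynamicLimit.Theses.CollisionIsometryCLT
import Summits.AtomisticToContinuum.HydrodynamicLimit.Theses.ImplosionDichotomy
-- (readout, used in stub_gronwall only) import Summits.AtomisticToContinuum.HydrodynamicLimit.Theorems.TwoClocksEntropyToHydro
import Literature.MathematicalPhysics.KineticTheory.HardSphereEulerProofs
import HarnessLib

/-!
# Crux `MacroClosure` (stmt-AtomisticToContinuum-14670) — line `IdeatorTwoSketch`: skeleton

Lead prover's skeleton for the crux
`Summit.AtomisticToContinuum.HydrodynamicLimit.Theses.CollisionIsometryCLT.MacroClosure :=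
CollisionalTransferLocality → AprioriBoundsPreShock → FastMomentRelaxationPreShock → HydrodynamicLimit`
(re-typed 2026-08-16T06:45Z as stmt-AtomisticToContinuum-14870 on the pre-shock items; same decl name, same
crux dossier) along the picked line (in-band docking of IdeatorTwoSketch + the Yau ledger of
`liouville-yau-transport`, merged by triage r1-1/r1-2).

Composition (`MacroClosure_of`, pure logic, sorry-free apart from the `stub_*`):

* `stub_chamber` = the existing item `ImplosionDichotomy.DiluteSelfConsistency` (stmt-3091): the
  classical solution stays in the dilute chamber `ρσ³ < η` for every `η > 0` at small `σ`;
* local in-band engine `EngineLocal` (profile-wise chamber level; with `stub_chamber` it gives the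
  conjunct exactly as `ImplosionDichotomy.closes` does) from the three closure hypotheses, by `stub_gronwall` (Yau's relative-entropy
  Gronwall on the law conditioned on the good event) fed by five INDEPENDENT stubs:
  `stub_referenceStatics` (steering activity realises the Euler state; exponential concentration —
  cluster-expansion statics, leans on `TwoClocks.UniformLocalGibbsConcentration` 14445),
  `stub_blockLD` (entropy-dominated block functionals have non-positive pressure under dilute local
  Gibbs laws — the static large-deviation upper bound), `stub_thermo` (hard-sphere thermodynamics in
  the chamber: entropy variables, entropy/entropy-flux compatibility, convexity), `stub_ledger`
  (exact finite-`N` entropy ledger for local Gibbs references + log-partition calculus),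
  `stub_balance` (pathwise tested balance on good trajectories, free-transport derivative, exact
  kinetic-flux algebra of block moments, mollifier commutator);
* readout: `Theorems.tendstoHydroFieldsAt_of_klDiv` (PROVED, TwoClocksEntropyToHydro) is used inside
  `stub_gronwall`.
-/

noncomputable section

open MeasureTheory Filter Set Topology InformationTheory
open scoped ENNReal ContDiff

namespace Summit.AtomisticToContinuum.HydrodynamicLimit.Theorems.MacroClosureLine

open Literature.MathematicalPhysics.KineticTheory Literature.Analysis.FluidPDE
open Literature.Analysis.FunctionSpaces
open Summit.AtomisticToContinuum.HydrodynamicLimit.Theses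
open Summit.AtomisticToContinuum.HydrodynamicLimit.Theses.CollisionIsometryCLT

/-! ## Vocabulary (abbreviations over tree declarations; all `Prop`s below are stated in it) -/

/-- Conserved state `U = (ρ, m, E)`. -/
abbrev State : Type := ℝ × V3 × ℝ

/-- Hard-sphere flows of `N + 1` spheres at reduced diameter `σ`. -/
abbrev Flow (σ : ℝ) (N : ℕ) : Type :=
  HardSphereFlow (Torus.geometry (Fin 3)) (hsDiameter σ N) (N + 1)

/-- Temperature of a state, `θ(U) = (2/3)(E/ρ − |m|²/(2ρ²))`. -/
def stateTemp (U : State) : ℝ := 2 / 3 * (U.2.2 / U.1 - ‖U.2.1‖ ^ 2 / (2 * U.1 ^ 2))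

/-- The convex hard-sphere entropy `η_σ(U) = −ρ((3/2) log θ − log ρ − f_ex(ρσ³))` (verbatim the `ησ`
of stmt-9520/9521/9525/9526). -/
def hsEntropy (σ : ℝ) (U : State) : ℝ :=
  -(U.1 * (3 / 2 * Real.log (2 / 3 * (U.2.2 / U.1 - ‖U.2.1‖ ^ 2 / (2 * U.1 ^ 2))) - Real.log U.1 -
    hsExcessFreeEnergy (U.1 * σ ^ 3)))

/-- The hs-Euler flux in direction `j` (verbatim the `Fl` of stmt-9520):
`F_j(U) = (m_j, (m_j/ρ) m + p e_j, (E + p) m_j/ρ)`, `p = hsPressure σ ρ θ(U)`. -/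
def eulerFlux (σ : ℝ) (j : Fin 3) (U : State) : State :=
  (U.2.1 j, (U.2.1 j / U.1) • U.2.1 + hsPressure σ U.1 (stateTemp U) • EuclideanSpace.single j (1 : ℝ),
    (U.2.2 + hsPressure σ U.1 (stateTemp U)) * U.2.1 j / U.1)

/-- Relative entropy density `h_σ(V | U) = η_σ(V) − η_σ(U) − Dη_σ(U)(V − U)`. -/
def relEnt (σ : ℝ) (V U : State) : ℝ :=
  hsEntropy σ V - hsEntropy σ U - fderiv ℝ (hsEntropy σ) U (V - U)

/-- Flux Taylor remainder `R_j(V | U) = F_j(V) − F_j(U) − DF_j(U)(V − U)`. -/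
def fluxRem (σ : ℝ) (j : Fin 3) (V U : State) : State :=
  eulerFlux σ j V - eulerFlux σ j U - fderiv ℝ (eulerFlux σ j) U (V - U)

/-- Conserved state of the primitive variables `(ρ, u, θ)`. -/
def stateOf (ρ : ℝ) (u : V3) (θ : ℝ) : State := (ρ, ρ • u, totalEnergyDensity ρ u θ)

/-- The physical (open) state domain `{ρ > 0, θ(U) > 0}` = `{0 < ρ, |m|² < 2ρE}`. -/
def physDom : Set State := {U | 0 < U.1 ∧ ‖U.2.1‖ ^ 2 < 2 * U.1 * U.2.2}

/-- The dilute chamber at level `η`: physical states with packing `ρσ³ < η`. -/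
def chamber (σ η : ℝ) : Set State := {U | 0 < U.1 ∧ U.1 * σ ^ 3 < η ∧ ‖U.2.1‖ ^ 2 < 2 * U.1 * U.2.2}

/-- The STEERING ACTIVITY of a density profile: `A_σ(ρ)(x) = ρ(x) · exp(f_ex(η) + η f_ex'(η))`,
`η = ρ(x)σ³` (activity–density relation of the hard-sphere gas: `log a = log ρ + βμ_ex`). -/
def steeringActivity (σ : ℝ) (ρ : T3 → ℝ) (x : T3) : ℝ :=
  ρ x * Real.exp (hsExcessFreeEnergy (ρ x * σ ^ 3) +
    ρ x * σ ^ 3 * deriv hsExcessFreeEnergy (ρ x * σ ^ 3))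

/-- Admissible kernel family (verbatim the six clauses of FMR / CTL / AB (ii)). -/
def AdmissibleKernel (γ C : ℝ) (φ : ℕ → T3 → ℝ) : Prop :=
  (∀ N, Torus.IsSmooth (φ N)) ∧ (∀ N y, 0 ≤ φ N y) ∧ (∀ N, ∫ y, φ N y = 1) ∧
  (∀ (N : ℕ) y, ((N : ℝ) + 1) ^ (-γ) ≤ Torus.euclidDist y 0 → φ N y = 0) ∧
  (∀ (N : ℕ) y, φ N y ≤ C * ((N : ℝ) + 1) ^ (3 * γ)) ∧
  (∀ (N : ℕ) y, ‖Torus.gradient (φ N) y‖ ≤ C * ((N : ℝ) + 1) ^ (4 * γ))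

section Blocks

variable {n : ℕ}

/-- Block density `ρ̄ = ⟨emp, φ(· − x)⟩`. -/
def bρ (φ : T3 → ℝ) (z : Config n (Fin 3) T3) (x : T3) : ℝ :=
  empiricalDensityField z (fun y => φ (y - x))

/-- Block momentum `m̄`. -/
def bm (φ : T3 → ℝ) (z : Config n (Fin 3) T3) (x : T3) : V3 :=
  empiricalMomentumField z (fun y => φ (y - x))

/-- Block energy `Ē`. -/
def bE (φ : T3 → ℝ) (z : Config n (Fin 3) T3) (x : T3) : ℝ :=
  empiricalEnergyField z (fun y => φ (y - x))

/-- Block velocity `ū = ρ̄⁻¹ m̄` (junk `0` on empty blocks). -/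
def bu (φ : T3 → ℝ) (z : Config n (Fin 3) T3) (x : T3) : V3 := (bρ φ z x)⁻¹ • bm φ z x

/-- Block temperature `θ̄ = (2/3)(Ē/ρ̄ − |m̄|²/(2ρ̄²))`. -/
def bθ (φ : T3 → ℝ) (z : Config n (Fin 3) T3) (x : T3) : ℝ :=
  2 / 3 * (bE φ z x / bρ φ z x - ‖bm φ z x‖ ^ 2 / (2 * bρ φ z x ^ 2))

/-- Block traceless central kinetic stress `D_jk` (verbatim FMR's `D`). -/
def bD (φ : T3 → ℝ) (z : Config n (Fin 3) T3) (x : T3) (j k : Fin 3) : ℝ :=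
  (∫ y, φ (y.1 - x) * ((y.2 j - bu φ z x j) * (y.2 k - bu φ z x k)) ∂(empiricalMeasure z)) -
    (if j = k then (∑ l : Fin 3, ∫ y, φ (y.1 - x) * (y.2 l - bu φ z x l) ^ 2 ∂(empiricalMeasure z)) / 3
      else 0)

/-- Block kinetic heat flux `q` (verbatim FMR's `q`). -/
def bq (φ : T3 → ℝ) (z : Config n (Fin 3) T3) (x : T3) : V3 :=
  ∫ y, (φ (y.1 - x) * ‖y.2 - bu φ z x‖ ^ 2 / 2) • (y.2 - bu φ z x) ∂(empiricalMeasure z)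

/-- Block conserved state `Ū = (ρ̄, m̄, Ē)`. -/
def bU (φ : T3 → ℝ) (z : Config n (Fin 3) T3) (x : T3) : State := (bρ φ z x, bm φ z x, bE φ z x)

end Blocks

/-- Empirical pairing with the log-profile of a local Gibbs parameter triple:
`⟨emp z, log (a(x) M_{1,u(x),θ(x)}(v))⟩`. -/
def logProfilePair {n : ℕ} (a : T3 → ℝ) (u : T3 → V3) (θ : T3 → ℝ) (z : Config n (Fin 3) T3) : ℝ :=
  ∫ y, Real.log (localGibbsProfile a u θ y) ∂(empiricalMeasure z)

/-- The canonical partition function of the local Gibbs profile `(a, u, θ)` for `N + 1` spheres. -/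
def Zpart (σ : ℝ) (N : ℕ) (a : T3 → ℝ) (u : T3 → V3) (θ : T3 → ℝ) : ℝ :=
  canonicalPartition (Torus.geometry (Fin 3)) (hsDiameter σ N) (N + 1) (localGibbsProfile a u θ)

/-! ## The stub statements -/

/-- STATICS 1 — the steering activity realises the prescribed smooth dilute state: for
`0 < σ < 1/2`, smooth `(ρ, u, θ)` with `ρ, θ > 0`, `∫ρ = 1`, `ρσ³ < η₁`, the local Gibbs laws with
activity `A_σ(ρ)` are probability measures whose empirical density / momentum / energy fields
concentrate exponentially around `(ρ, ρu, E(ρ,u,θ))`, with a uniform second moment of the kinetic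
energy, and `A_σ(ρ)` is (up to a constant factor) the ONLY dilute activity with this law of large
numbers. Cluster-expansion statics (ULGC, stmt-14445) + the activity–density identity. -/
def ReferenceStatics (η₁ : ℝ) : Prop :=
  ∀ σ : ℝ, 0 < σ → σ < 2⁻¹ → ∀ (ρ θ : T3 → ℝ) (u : T3 → V3),
    Torus.IsSmooth ρ → Torus.IsSmooth θ → Torus.IsSmooth u → (∀ x, 0 < ρ x) → (∀ x, 0 < θ x) →
    (∀ x, ρ x * σ ^ 3 < η₁) → ∫ x, ρ x = 1 →
    Continuous (steeringActivity σ ρ) ∧ (∀ x, 0 < steeringActivity σ ρ x) ∧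
    (∀ (N : ℕ) (Φ : Flow σ N), IsProbabilityMeasure (localGibbsLaw σ (steeringActivity σ ρ) u θ N Φ)) ∧
    (∀ χ : T3 → ℝ, Continuous χ → ∀ δ : ℝ, 0 < δ → ∃ C : ℝ, 0 < C ∧ ∀ (N : ℕ) (Φ : Flow σ N),
      localGibbsLaw σ (steeringActivity σ ρ) u θ N Φ
          {z | δ < |empiricalDensityField z χ - ∫ x, χ x * ρ x|} ≤
        ENNReal.ofReal (C * Real.exp (-(C⁻¹ * (N + 1)))) ∧
      localGibbsLaw σ (steeringActivity σ ρ) u θ N Φ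
          {z | δ < ‖empiricalMomentumField z χ - ∫ x, (χ x * ρ x) • u x‖} ≤
        ENNReal.ofReal (C * Real.exp (-(C⁻¹ * (N + 1)))) ∧
      localGibbsLaw σ (steeringActivity σ ρ) u θ N Φ
          {z | δ < |empiricalEnergyField z χ - ∫ x, χ x * totalEnergyDensity (ρ x) (u x) (θ x)|} ≤
        ENNReal.ofReal (C * Real.exp (-(C⁻¹ * (N + 1))))) ∧
    (∃ C₂ : ℝ, ∀ (N : ℕ) (Φ : Flow σ N),
      ∫ z, (empiricalEnergyField z fun _ => (1 : ℝ)) ^ 2 ∂(localGibbsLaw σ (steeringActivity σ ρ) u θ N Φ)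
        ≤ C₂) ∧
    (∀ a' : T3 → ℝ, Continuous a' → (∀ x, 0 < a' x) → σ ^ 3 * (⨆ x, a' x) ≤ η₁ * ∫ x, a' x →
      (∀ Φ : (N : ℕ) → Flow σ N,
        TendstoHydroFieldsAt (fun N => localGibbsLaw σ a' u θ N (Φ N)) Φ (fun _ => ρ) (fun _ => u)
          (fun _ => θ) 0) →
      ∃ c : ℝ, 0 < c ∧ ∀ x, a' x = c * steeringActivity σ ρ x)

/-- STATICS 2 — block large deviations of dilute local Gibbs laws, in Varadhan's one-sided form
along a smooth space–time family: a bounded continuous block functional `∫ₓ G_s(x, Ū_N(z,x)) dx` that is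
dominated pointwise by the relative entropy density `h_σ(· | U_s(x))` has non-positive specific
pressure under the steered local Gibbs law, uniformly in `s ∈ [0,t]` and in the flow:
`E_Ψ exp((N+1) ∫ₓ G_s(x, Ū)) ≤ e^{ε(N+1)}` eventually. -/
def BlockLD (η₂ : ℝ) : Prop :=
  ∀ σ : ℝ, 0 < σ → σ < 2⁻¹ → ∀ (t : ℝ), 0 ≤ t → ∀ (ρ θ : ℝ → T3 → ℝ) (u : ℝ → T3 → V3),
    Torus.IsSmoothSpaceTimeOn (Icc 0 t) ρ → Torus.IsSmoothSpaceTimeOn (Icc 0 t) θ →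
    Torus.IsSmoothSpaceTimeOn (Icc 0 t) u → (∀ s ∈ Icc 0 t, ∀ x, 0 < ρ s x) →
    (∀ s ∈ Icc 0 t, ∀ x, 0 < θ s x) → (∀ s ∈ Icc 0 t, ∀ x, ρ s x * σ ^ 3 < η₂) →
    (∀ s ∈ Icc 0 t, ∫ x, ρ s x = 1) →
    ∀ (γ C : ℝ) (φ : ℕ → T3 → ℝ), 0 < γ → γ ≤ 1 / 15 → AdmissibleKernel γ C φ →
    ∀ (G : ℝ → T3 × State → ℝ) (B : ℝ), ContinuousOn (Function.uncurry G) (Icc 0 t ×ˢ univ) →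
      (∀ s ∈ Icc 0 t, ∀ p, |G s p| ≤ B) →
      (∀ s ∈ Icc 0 t, ∀ x, ∀ V ∈ physDom, G s (x, V) ≤ relEnt σ V (stateOf (ρ s x) (u s x) (θ s x))) →
      ∀ ε : ℝ, 0 < ε → ∀ᶠ N : ℕ in atTop, ∀ s ∈ Icc 0 t, ∀ Φ : Flow σ N,
        ∫ z, Real.exp (((N : ℝ) + 1) * ∫ x, G s (x, bU (φ N) z x))
            ∂(localGibbsLaw σ (steeringActivity σ (ρ s)) (u s) (θ s) N Φ) ≤
          Real.exp (ε * ((N : ℝ) + 1))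

/-- THERMODYNAMICS in the chamber — for a classical hs-Euler solution with packing `< η₃`: the
entropy-variable field `Λ = Dη_σ(U_cl)` is smooth, has the explicit form
`Λ V = λ⁰ V.ρ + ⟪u/θ, V.m⟫ − V.E/θ` with `λ⁰ = log ρ + f_ex + ηf_ex' − (3/2)log θ − |u|²/(2θ) + 5/2`
(so the steered local Gibbs log-profile is `Λ·(1, v, |v|²/2) + const`), satisfies the entropy /
entropy-flux compatibility `∂ₛΛ·V + Σⱼ ∂ⱼΛ·DFⱼ(U_cl)V = 0` and `∫ Σⱼ ∂ⱼΛ·Fⱼ(U_cl) = 0`; the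
fluxes and the entropy are smooth on the chamber; and `h_σ(V|U)` is non-negative on the band and
bounded below by `m·min(|V−U|², |V−U|)` uniformly for `U` in compact parts of the chamber
(strict convexity at `U` from HsEosLowDensity, convexity on the band = HsFreeEnergyConvex 9526). -/
def ThermoChamber (η₃ : ℝ) : Prop :=
  ∀ σ : ℝ, 0 < σ →
    (ContDiffOn ℝ ∞ (hsEntropy σ) (chamber σ η₃) ∧ ∀ j, ContDiffOn ℝ ∞ (eulerFlux σ j) (chamber σ η₃)) ∧
    (∀ K : Set State, IsCompact K → K ⊆ chamber σ η₃ → ∃ m : ℝ, 0 < m ∧ ∀ U ∈ K, ∀ V : State,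
      0 < V.1 → V.1 * σ ^ 3 < 11 / 10 → ‖V.2.1‖ ^ 2 < 2 * V.1 * V.2.2 →
      m * min (‖V - U‖ ^ 2) ‖V - U‖ ≤ relEnt σ V U) ∧
    ∀ (T : ℝ) (ρ θ : ℝ → T3 → ℝ) (u : ℝ → T3 → V3), IsHardSphereEulerSolution σ T ρ u θ →
      (∀ s ∈ Ico 0 T, ∀ x, ρ s x * σ ^ 3 < η₃) →
      let U : ℝ → T3 → State := fun s x => stateOf (ρ s x) (u s x) (θ s x)
      let Λ : ℝ → T3 → (State →L[ℝ] ℝ) := fun s x => fderiv ℝ (hsEntropy σ) (U s x)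
      Torus.IsSmoothSpaceTimeOn (Ico 0 T) Λ ∧
      (∀ s ∈ Ico 0 T, ∀ x, ∀ V : State,
        Λ s x V = (Real.log (ρ s x) + hsExcessFreeEnergy (ρ s x * σ ^ 3) +
            ρ s x * σ ^ 3 * deriv hsExcessFreeEnergy (ρ s x * σ ^ 3) -
            3 / 2 * Real.log (θ s x) - ‖u s x‖ ^ 2 / (2 * θ s x) + 5 / 2) * V.1 +
          inner ℝ ((θ s x)⁻¹ • u s x) V.2.1 - (θ s x)⁻¹ * V.2.2) ∧
      (∀ s ∈ Ico 0 T, ∀ x, ∀ V : State,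
        Torus.timeDerivWithin (Ico 0 T) Λ s x V +
          ∑ j, Torus.partialDeriv j (Λ s) x (fderiv ℝ (eulerFlux σ j) (U s x) V) = 0) ∧
      (∀ s ∈ Ico 0 T, ∫ x, ∑ j, Torus.partialDeriv j (Λ s) x (eulerFlux σ j (U s x)) = 0)

/-- LEDGER — exact finite-`N` bookkeeping for local Gibbs references: (L0) the canonical local Gibbs
law is invariant under scaling of the activity; (L1) two-reference Liouville transport identity
`H((Φ_t)_* P ‖ Ψ₂) = H(P ‖ Ψ₁) + (N+1) E_P[⟨emp, log prof₁⟩ − ⟨emp∘Φ_t, log prof₂⟩] + log Z₂ − log Z₁`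
for any absolutely continuous initial law `P = W₀ · dZ`; (L2) the log-partition function of a smooth
one-parameter family of local Gibbs profiles is differentiable with derivative
`(N+1) E_{Ψ_s}⟨emp, ∂ₛ log prof_s⟩`, continuously in `s`. -/
def LedgerIdentity : Prop :=
  ∀ σ : ℝ, 0 < σ → σ < 2⁻¹ → ∀ (N : ℕ) (Φ : Flow σ N),
    (∀ (a θ : T3 → ℝ) (u : T3 → V3) (c : ℝ), 0 < c →
      localGibbsLaw σ (fun x => c * a x) u θ N Φ = localGibbsLaw σ a u θ N Φ) ∧
    (∀ (a₁ θ₁ a₂ θ₂ : T3 → ℝ) (u₁ u₂ : T3 → V3), Continuous a₁ → Continuous θ₁ → Continuous u₁ →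
      Continuous a₂ → Continuous θ₂ → Continuous u₂ → (∀ x, 0 < a₁ x) → (∀ x, 0 < θ₁ x) →
      (∀ x, 0 < a₂ x) → (∀ x, 0 < θ₂ x) →
      ∀ (W₀ : Config (N + 1) (Fin 3) T3 → ℝ), Measurable W₀ → (∀ z, 0 ≤ W₀ z) →
      IsProbabilityMeasure (particleLaw Φ W₀) →
      klDiv (particleLaw Φ W₀) (localGibbsLaw σ a₁ u₁ θ₁ N Φ) ≠ ⊤ →
      ∀ t : ℝ,
      Integrable (fun z => ∫ y, ‖y.2‖ ^ 2 ∂(empiricalMeasure z)) (particleLaw Φ W₀) →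
      Integrable (fun z => ∫ y, ‖y.2‖ ^ 2 ∂(empiricalMeasure (Φ.flow t z))) (particleLaw Φ W₀) →
      (klDiv (Φ.lawAt (particleLaw Φ W₀) t) (localGibbsLaw σ a₂ u₂ θ₂ N Φ)).toReal =
        (klDiv (particleLaw Φ W₀) (localGibbsLaw σ a₁ u₁ θ₁ N Φ)).toReal +
          ((N : ℝ) + 1) * ((∫ z, logProfilePair a₁ u₁ θ₁ z ∂(particleLaw Φ W₀)) -
            ∫ z, logProfilePair a₂ u₂ θ₂ (Φ.flow t z) ∂(particleLaw Φ W₀)) +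
          Real.log (Zpart σ N a₂ u₂ θ₂) - Real.log (Zpart σ N a₁ u₁ θ₁)) ∧
    (∀ (t : ℝ), 0 < t → ∀ (a θ : ℝ → T3 → ℝ) (u : ℝ → T3 → V3),
      Torus.IsSmoothSpaceTimeOn (Icc 0 t) a → Torus.IsSmoothSpaceTimeOn (Icc 0 t) θ →
      Torus.IsSmoothSpaceTimeOn (Icc 0 t) u → (∀ s ∈ Icc 0 t, ∀ x, 0 < a s x) →
      (∀ s ∈ Icc 0 t, ∀ x, 0 < θ s x) →
      let dlog : ℝ → Config (N + 1) (Fin 3) T3 → ℝ := fun s z =>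
        ∫ y, derivWithin (fun s' => Real.log (localGibbsProfile (a s') (u s') (θ s') y)) (Icc 0 t) s
          ∂(empiricalMeasure z)
      (∀ s ∈ Icc 0 t, HasDerivWithinAt (fun s' => Real.log (Zpart σ N (a s') (u s') (θ s')))
        (((N : ℝ) + 1) * ∫ z, dlog s z ∂(localGibbsLaw σ (a s) (u s) (θ s) N Φ)) (Icc 0 t) s) ∧
      ContinuousOn (fun s => ∫ z, dlog s z ∂(localGibbsLaw σ (a s) (u s) (θ s) N Φ)) (Icc 0 t))

/-- BALANCE — pathwise and algebraic bookkeeping of the tested balance laws: (B1) on good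
trajectories the position functional `⟨emp(Φ_s z), λ⁰_s⟩` is the time integral of
`⟨emp, ∂ₛλ⁰ + v·∇λ⁰⟩` (positions are continuous and piecewise free); (B2) the free-transport
derivative of CTL's observable `O` is the microscopic kinetic flux `⟨emp, Σⱼₖ ∂ⱼψₖ vⱼvₖ + Σⱼ ∂ⱼχ vⱼ|v|²/2⟩`;
(B3) the EXACT kinetic-flux algebra of non-negative kernels: block second moments
`= ρ̄ūⱼūₖ + ρ̄θ̄δⱼₖ + Dⱼₖ`, block energy current `= (Ē + ρ̄θ̄)ūⱼ + Σₖ Dⱼₖūₖ + qⱼ`; (B4) the mollifier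
commutator `|⟨emp, w g⟩ − ∫ₓ w(x)⟨emp, φ(·−x) g⟩| ≤ r‖∇w‖∞⟨emp, |g|⟩` for kernels supported in
`euclidDist(·,0) < r` with unit mass. -/
def BalanceIdentity : Prop :=
  (∀ σ : ℝ, 0 < σ → σ < 2⁻¹ → ∀ (N : ℕ) (Φ : Flow σ N) (t : ℝ), 0 < t →
    ∀ lam0 : ℝ → T3 → ℝ, Torus.IsSmoothSpaceTimeOn (Icc 0 t) lam0 →
    ∀ z ∈ Φ.good, ∀ τ ∈ Icc 0 t,
      (∫ y, lam0 τ y.1 ∂(empiricalMeasure (Φ.flow τ z))) - ∫ y, lam0 0 y.1 ∂(empiricalMeasure z) =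
        ∫ s in Icc 0 τ, ∫ y, (Torus.timeDerivWithin (Icc 0 t) lam0 s y.1 +
          ∑ j, y.2 j * Torus.partialDeriv j (lam0 s) y.1) ∂(empiricalMeasure (Φ.flow s z))) ∧
  (∀ (N : ℕ) (ψ : T3 → V3) (χ : T3 → ℝ), Torus.IsSmooth ψ → Torus.IsSmooth χ →
    ∀ z : Config (N + 1) (Fin 3) T3,
      HasDerivAt (fun r : ℝ => ∫ y, ((∑ j, ψ y.1 j * y.2 j) + χ y.1 * (‖y.2‖ ^ 2 / 2))
          ∂(empiricalMeasure (freeFlight (Torus.geometry (Fin 3)) r z)))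
        (∫ y, ((∑ j, ∑ k, Torus.partialDeriv j (fun x => ψ x k) y.1 * (y.2 j * y.2 k)) +
            ∑ j, Torus.partialDeriv j χ y.1 * (y.2 j * (‖y.2‖ ^ 2 / 2))) ∂(empiricalMeasure z)) 0) ∧
  (∀ (N : ℕ) (φ : T3 → ℝ), (∀ y, 0 ≤ φ y) → ∀ (z : Config (N + 1) (Fin 3) T3) (x : T3),
    (∀ j k : Fin 3, ∫ y, φ (y.1 - x) * (y.2 j * y.2 k) ∂(empiricalMeasure z) =
      bρ φ z x * (bu φ z x j * bu φ z x k) + (if j = k then bρ φ z x * bθ φ z x else 0) +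
        bD φ z x j k) ∧
    (∀ j : Fin 3, ∫ y, φ (y.1 - x) * (‖y.2‖ ^ 2 / 2 * y.2 j) ∂(empiricalMeasure z) =
      (bE φ z x + bρ φ z x * bθ φ z x) * bu φ z x j + (∑ k, bD φ z x j k * bu φ z x k) +
        bq φ z x j)) ∧
  (∀ (N : ℕ) (φ : T3 → ℝ) (r L : ℝ), (∀ y, 0 ≤ φ y) → Integrable φ → ∫ y, φ y = 1 →
    (∀ y, r ≤ Torus.euclidDist y 0 → φ y = 0) →
    ∀ w : T3 → ℝ, Torus.IsSmooth w → (∀ x, ‖Torus.gradient w x‖ ≤ L) →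
    ∀ (g : V3 → ℝ) (z : Config (N + 1) (Fin 3) T3),
      |(∫ y, w y.1 * g y.2 ∂(empiricalMeasure z)) -
          ∫ x, w x * ∫ y, φ (y.1 - x) * g y.2 ∂(empiricalMeasure z)| ≤
        r * L * ∫ y, |g y.2| ∂(empiricalMeasure z))

/-- The LOCAL IN-BAND ENGINE (profile-wise chamber level, matching the pre-shock hypotheses of the
re-typed crux stmt-14870): for all profiles there are `σ₀ > 0` and a dilute level `η > 0` such that for
`σ < σ₀` every classical solution with LLN-matching local Gibbs data that stays in the chamber
`ρσ³ < η` on `[0,T)` propagates the law of large numbers to every `t < T`. With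
`DiluteSelfConsistency` (stmt-3091, `∀ η > 0` outermost) this gives the conjunct. -/
def EngineLocal : Prop :=
  ∀ (a₀ θ₀ : T3 → ℝ) (u₀ : T3 → V3), Continuous a₀ → Continuous θ₀ → Continuous u₀ →
    (∀ x, 0 < a₀ x) → (∀ x, 0 < θ₀ x) →
    ∃ σ₀ : ℝ, 0 < σ₀ ∧ ∃ η : ℝ, 0 < η ∧ ∀ σ : ℝ, 0 < σ → σ < σ₀ →
      ∀ (T : ℝ) (ρ θ : ℝ → T3 → ℝ) (u : ℝ → T3 → V3), IsHardSphereEulerSolution σ T ρ u θ →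
        ∀ Φ : (N : ℕ) → Flow σ N,
          TendstoHydroFieldsAt (fun N => localGibbsLaw σ a₀ u₀ θ₀ N (Φ N)) Φ ρ u θ 0 →
            (∀ t ∈ Ico 0 T, ∀ x, ρ t x * σ ^ 3 < η) →
            ∀ t ∈ Ico 0 T, TendstoHydroFieldsAt (fun N => localGibbsLaw σ a₀ u₀ θ₀ N (Φ N)) Φ ρ u θ t

/-! ## Stubs -/

/-- STUB (existing item stmt-AtomisticToContinuum-3091, route ImplosionDichotomy): the dilute chamber. -/
theorem stub_chamber : ImplosionDichotomy.DiluteSelfConsistency := by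
  sorry

/-- STUB: steering-activity statics at some dilute level. -/
theorem stub_referenceStatics : ∃ η₁ : ℝ, 0 < η₁ ∧ ReferenceStatics η₁ := by
  sorry

/-- STUB: block large deviations of dilute local Gibbs laws at some dilute level. -/
theorem stub_blockLD : ∃ η₂ : ℝ, 0 < η₂ ∧ BlockLD η₂ := by
  sorry

/-- STUB: hard-sphere thermodynamics in the chamber at some dilute level. -/
theorem stub_thermo : ∃ η₃ : ℝ, 0 < η₃ ∧ ThermoChamber η₃ := by
  sorry

/-- STUB: the finite-`N` entropy ledger. -/
theorem stub_ledger : LedgerIdentity := by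
  sorry

/-- STUB: the pathwise / algebraic balance bookkeeping. -/
theorem stub_balance : BalanceIdentity := by
  sorry

/-- STUB (hardest; lead): Yau's relative-entropy Gronwall on the conditioned law. Given the five
independent inputs and the three closure hypotheses of the (re-typed, pre-shock) crux, the local
in-band engine holds, at the profile-wise level `min(η₁, η₂, η₃, η_AB/2, η_FMR/2)`.
[cite: Yau1991, §2] [cite: KipnisLandim1999, Ch. 6 Thm 1.1] -/
theorem stub_gronwall (η₁ η₂ η₃ : ℝ) (hη₁ : 0 < η₁) (hη₂ : 0 < η₂) (hη₃ : 0 < η₃)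
    (hR : ReferenceStatics η₁) (hL : BlockLD η₂) (hT : ThermoChamber η₃) (hI : LedgerIdentity)
    (hB : BalanceIdentity) (hC : CollisionalTransferLocality) (hA : AprioriBoundsPreShock)
    (hF : FastMomentRelaxationPreShock) : EngineLocal := by
  sorry

/-! ## Composition (pure logic) -/

/-- **The crux from the stubs** (in-band docking of IdeatorTwoSketch, re-keyed on the pre-shock
items of stmt-14870: the local engine supplies `σ₀, η` per profile triple; dilute self-consistency
`stub_chamber` at level `η` supplies the packing guard on `[0,T)`; `σ₀ := min` of the two). [folklore] -/
theorem MacroClosure_of : MacroClosure := by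
  intro hC hA hF
  obtain ⟨η₁, hη₁, hR⟩ := stub_referenceStatics
  obtain ⟨η₂, hη₂, hL⟩ := stub_blockLD
  obtain ⟨η₃, hη₃, hT⟩ := stub_thermo
  have hE : EngineLocal :=
    stub_gronwall η₁ η₂ η₃ hη₁ hη₂ hη₃ hR hL hT stub_ledger stub_balance hC hA hF
  intro a₀ θ₀ u₀ ha hθ hu ha0 hθ0
  obtain ⟨σ₁, hσ₁, η, hη, HE⟩ := hE a₀ θ₀ u₀ ha hθ hu ha0 hθ0
  obtain ⟨σ₂, hσ₂, HD⟩ := stub_chamber η hη a₀ θ₀ u₀ ha hθ hu ha0 hθ0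
  refine ⟨min σ₁ σ₂, lt_min hσ₁ hσ₂, ?_⟩
  intro σ hσ hσlt T ρ θ u hsol Φ h0 t ht
  exact HE σ hσ (lt_of_lt_of_le hσlt (min_le_left _ _)) T ρ θ u hsol Φ h0
    (fun s hs x => HD σ hσ (lt_of_lt_of_le hσlt (min_le_right _ _)) T ρ θ u hsol Φ h0 s hs x) t ht

end Summit.AtomisticToContinuum.HydrodynamicLimit.Theorems.MacroClosureLine

end
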